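import Summits.Schanuel.Schanuel.Theorems.RootDecomp1KSkelCell07

/-!
# RootDecomp1KSkelCell — lens 1, generations 43–44 «THE QUALITY-ONLY CLASS SkelLiouville ⊋ LogLogLiouville AND ITS CERTIFIED MEMBER ρ⋆» (PRICE K-α L2033, CLAIM L2045, ACK L2046; (α) PROPER of the 1K wall map): the location-free class `SkelLiouville ρ := ∀ m ∃ r, m ≤ den r ∧ ρ ≠ r ∧ |ρ − r| < den^{−m·ι(den)}` (ι q = least N with q ≤ 2^{N!}) with `LogLogLiouville ⊊ SkelLiouville ⊆ Liouville` PROVED, the member ρ⋆ = Σ_j 2^{−2^{e_j}} (FREDHOLM SERIES WITH DELETED BLOCKS) certified HYPOTHESIS-FREE in Skel ∖ (LogLog ∪ FactorialGap), the SKEL engine + extraction, the walls (1, ℓ₂, ρ) mod hNW / π-twins and the pair (ℓ₂, ρ) HYPOTHESIS-FREE for every ρ ∈ Skel, the items APPLIED at z⋆ with all binders discharged, the m = 1 ceiling, and §9 hNW DISCHARGED BY NAME on the e-wall via the Literature proof module — continuation (RootDecomp1KSkelCell08): §7 three interlaced cuts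

(lens-1 g43/g44 HOME kernel SkelCell.lean EDITION 2 b7163857…, 2822 l, imports tree RootDecomp1KGapCell01 (+ for §9 only Literature ExpOneTranscendenceMeasureProofs); CLAIM L2045, ACK L2046 (CHECKLIST K-α (1)–(8) + the constant-dependence line of L2085 (R4)), NODE L2132 / REQUEST L2133, critic VERDICT L2140 (crit g9: CLEARED — ONE CELL credit (K-α); lens-1 tally credits ×11 + THEOREM; PORT GO in substance 01–0k `--supports stmt-Schanuel-33364`, the two scoped heartbeat raises flagged for the port record, addendum D as RootDecomp1KNWMeasureHolds GO LOW); port by census-1 gen 18 as `RootDecomp1KSkelCell01`–`11` along K's sections: 01 = §1 `iota`, `SkelLiouville`, inclusions `SkelLiouville.liouville` / `logLogLiouville_skelLiouville`; 02 = §5a anchors `aI`/`sI` + §5b the skeleton `eS`, positions `cS`, terms `aS` (up to `summable_aS`); 03 = §5b the member `rhoStar`, truncations `tS`/`rS`, bounds + §6 covering / quality lemmas; 04 = §6 THE MEMBER THEOREMS `skelLiouville_rhoStar`, `not_logLogLiouville_rhoStar`, `not_factorialGapLiouville_rhoStar`, `liouville_rhoStar`, `not_skelLiouville_subset_logLogLiouville`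 + §2 engine preliminaries (`SkelMeasure`, `exists_scale_index_iota`); 05 = §2 THE ENGINE `skelMeasure_cons_liouvilleNumber` (scoped `maxHeartbeats 800000` as in K) + `SkelMeasure.mvWeakMeasure`; 06 = §3 EXTRACTION `no_int_relation_of_skelMeasure_skelLiouville`, `sb_of_skelLiouville_of_skelMeasure`; 07 = §4 THE CELLS (pair hyp-free, walls mod hNW, π-twins) + the live items in item shape; 08 = §7 three interlaced cuts `deletedBlock_margins`, `form_lower_bound_S` (scoped `maxHeartbeats 1600000`); 09 = §7b member tuples zS2/zS3/zS3pi, scope certificates, items AT the members; 10 = §8 the fixed-multiple ladder and the m = 1 ceiling (`uStar`, `skel_fixedOne_ceiling`); 11 = §9 hNW DISCHARGED BY NAME (imports Literature ExpOneTranscendenceMeasureProofs).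
PORT EDITS: `set_option linter.dupNamespace false` dropped; the Literature import moved from the head to part 11 (the only user); K's 13 private helpers travel as per-part private copies; two generic helpers made `private` after the dedup bounce of 02 (p829539: `two_mul_le_two_pow` ≡ Literature.NumberTheory.EllipticCurves.two_mul_le_two_pow; also `log_two_lt_self` pre-emptively) and of 03 (p829791: `one_le_loglog` ≡ Literature Tao2016.EntropyDecrement.one_le_log_log; then nine more generic arithmetic helpers privatised pre-emptively: loglog_pow_pow_ge, add_factorial_mul_le_factorial_add, one_lt_ell2, partialSum_two_two, five_fourths_le_partialSum, ell2_lt, psNumer_two_cast, two_pow_lt_psNumer); and of 07 (p830787: the read-back `sb_logLogWall3_via_skel` ≡ tree `RootDecomp1KLogLogCell.sb_logLogCell` → private; in §9 likewise `nwMeasure_holds` and `sb_logLogWall3_via_skel'`, whose statements coincide with the census port RootDecomp1KNWMeasureHolds — `nwMeasure_holds` / `polyMeasure_exp_one_holds` / `sb_logLogCell'` there); statements and proofs verbatim. `--supports stmt-Schanuel-33364`; no census credit carried; rung 0 — nothing here proves Schanuel.)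
-/

open Summit.Schanuel.Schanuel.Theorems.RootDecomp1KHyper
open Summit.Schanuel.Schanuel.Theorems.RootDecomp1KHyper.HyperCell
open Summit.Schanuel.Schanuel.Theorems.RootDecomp1KGeneric
open Summit.Schanuel.Schanuel.Theorems.RootDecomp1KRelLiouvilleCell
open Summit.Schanuel.Schanuel.Theorems.RootDecomp1KLogLogCell
open Summit.Schanuel.Schanuel.Theorems.RootDecomp1KTwoBaseCell
open Summit.Schanuel.Schanuel.Theorems.RootDecomp1KGapCell
open LiouvilleNumber
open scoped Nat

namespace Summit.Schanuel.Schanuel.Theorems.RootDecomp1KSkelCell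

/-! ## §7  NO HYPER-SMALL FORMS IN `(1, ℓ₂, ρ⋆)` — THREE INTERLACED CUTS AT A DELETED BLOCK (hypothesis-free)

At the anchor `i` (least `i ≥ 4` with `8H ≤ 2^{(2^i)!}`, `M := 2^i`) the binary exponents of `ρ⋆` JUMP from
`2^{a_i} ∈ (M!, 2M!]` to `2^{a_i+s_i} ≥ 4M · 2^{a_i}`, and `M! < 2^{a_i} < (M+1)! < 2^{a_i+s_i} < (M+2)!` with all
four gaps `≥ M!`: the truncations at the three cuts `(M, j)`, `(M+1, j)`, `(M+1, j+1)` (`ℓ₂`-index, `ρ⋆`-index)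
have resolutions `2^{−2^{a_i}}`, `2^{−(M+1)!}`, `2^{−2^{a_i+s_i}}`, errors at most HALF of these, one of them is
non-zero, and `2^{a_i+s_i} + 1 ≤ (1+H)^{85}` by minimality of `i`. -/

section ThreeCuts

/-- Approximation of the form by its truncation at cut `(K, N)`. -/
private theorem formS_approx (g : Fin 3 → ℤ) (K N : ℕ) :
    |((g 0 : ℝ) + g 1 * liouvilleNumber 2 + g 2 * rhoStar) -
      ((g 0 : ℝ) + g 1 * partialSum 2 K + g 2 * tS N)| ≤
      |(g 1 : ℝ)| * (2 / 2 ^ (K + 1)!) + |(g 2 : ℝ)| * (2 / (2 : ℝ) ^ cS (N + 1)) := by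
  have h2 := (abs_liouvilleNumber_two_sub_partialSum K).le
  have hW := rhoStar_eq_tS_add N
  have tle := tailS_le N
  have tpos := tailS_pos N
  have e : ((g 0 : ℝ) + g 1 * liouvilleNumber 2 + g 2 * rhoStar) -
      ((g 0 : ℝ) + g 1 * partialSum 2 K + g 2 * tS N) =
      g 1 * (liouvilleNumber 2 - partialSum 2 K) + g 2 * ∑' j, aS (j + (N + 1)) := by rw [hW]; ring
  rw [e]
  calc |(g 1 : ℝ) * (liouvilleNumber 2 - partialSum 2 K) + g 2 * ∑' j, aS (j + (N + 1))|
      ≤ |(g 1 : ℝ)| * |liouvilleNumber 2 - partialSum 2 K| + |(g 2 : ℝ)| * ∑' j, aS (j + (N + 1)) := by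
        refine (abs_add_le _ _).trans ?_
        rw [abs_mul, abs_mul, abs_of_pos tpos]
    _ ≤ |(g 1 : ℝ)| * (2 / 2 ^ (K + 1)!) + |(g 2 : ℝ)| * (2 / (2 : ℝ) ^ cS (N + 1)) :=
        add_le_add (mul_le_mul_of_nonneg_left h2 (abs_nonneg _))
          (mul_le_mul_of_nonneg_left tle (abs_nonneg _))

/-- Scale lower bound: a NON-ZERO truncation with cut `(K, N)` is `≥ 2^{−e}` whenever `K! ≤ e` and `c_N ≤ e`
(ONE radix: the common denominator is `2^e`). -/
private theorem formS_scale_lower (g : Fin 3 → ℤ) {K N e : ℕ} (hK : K ! ≤ e) (hN : cS N ≤ e)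
    (hne : (g 0 : ℝ) + g 1 * partialSum 2 K + g 2 * tS N ≠ 0) :
    1 / (2 : ℝ) ^ e ≤ |(g 0 : ℝ) + g 1 * partialSum 2 K + g 2 * tS N| := by
  have hp : partialSum 2 K = (psNumer 2 K : ℝ) / 2 ^ K ! := by
    have := partialSum_eq_psNumer_div (by norm_num : 0 < 2) K
    push_cast at this
    exact this
  set I : ℤ := g 0 * 2 ^ e + g 1 * (psNumer 2 K) * 2 ^ (e - K !) + g 2 * (MS N) * 2 ^ (e - cS N) with hI
  have hΦ : (g 0 : ℝ) + g 1 * partialSum 2 K + g 2 * tS N = (I : ℝ) / 2 ^ e := by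
    rw [hp, tS_eq, hI]
    push_cast
    rw [pow_sub₀ _ (two_ne_zero) hK, pow_sub₀ _ (two_ne_zero) hN]
    field_simp
  rw [hΦ] at hne ⊢
  have hI0 : I ≠ 0 := by
    intro h0; apply hne; rw [h0]; simp
  have hI1 : (1 : ℝ) ≤ |(I : ℝ)| := by exact_mod_cast Int.one_le_abs hI0
  rw [abs_div, abs_of_pos (by positivity : (0 : ℝ) < 2 ^ e)]
  exact div_le_div_of_nonneg_right hI1 (by positivity)

/-- **Three cuts:** if the truncations at the cuts `(K, N)`, `(K+1, N)`, `(K+1, N+1)` all vanish then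
`g₁ = g₂ = 0` (each step adds ONE new term of ONE of the two series). -/
private theorem formS_three_scale (g : Fin 3 → ℤ) (K N : ℕ)
    (h1 : (g 0 : ℝ) + g 1 * partialSum 2 K + g 2 * tS N = 0)
    (h2 : (g 0 : ℝ) + g 1 * partialSum 2 (K + 1) + g 2 * tS N = 0)
    (h3 : (g 0 : ℝ) + g 1 * partialSum 2 (K + 1) + g 2 * tS (N + 1) = 0) : g 1 = 0 ∧ g 2 = 0 := by
  rw [partialSum_succ] at h2 h3
  have tS' : tS (N + 1) = tS N + aS (N + 1) := by unfold tS; rw [Finset.sum_range_succ]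
  rw [tS'] at h3
  have d1 : (g 1 : ℝ) / 2 ^ (K + 1)! = 0 := by linear_combination h2 - h1
  have d2 : (g 2 : ℝ) * aS (N + 1) = 0 := by linear_combination h3 - h2
  constructor
  · have h : (g 1 : ℝ) = 0 := by
      rcases div_eq_zero_iff.mp d1 with h | h
      · exact h
      · exact absurd h (by positivity)
    exact_mod_cast h
  · have h : (g 2 : ℝ) = 0 := (mul_eq_zero.mp d2).resolve_right (aS_pos _).ne'
    exact_mod_cast h

/-- `4 i ≤ 2^i` for `i ≥ 4`. -/
private theorem four_mul_le_two_pow {i : ℕ} (hi : 4 ≤ i) : 4 * i ≤ 2 ^ i := by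
  obtain ⟨t, rfl⟩ : ∃ t, i = t + 4 := ⟨i - 4, by omega⟩
  have h := (Nat.lt_two_pow_self : t < 2 ^ t)
  rw [pow_add]
  omega

/-- `m (m-1) (m-2) ≤ m!`. -/
private theorem mul_mul_le_factorial {m : ℕ} (hm : 2 ≤ m) : m * (m - 1) * (m - 2) ≤ m ! := by
  obtain ⟨t, rfl⟩ : ∃ t, m = t + 2 := ⟨m - 2, by omega⟩
  simp only [Nat.add_sub_cancel, show t + 2 - 1 = t + 1 by omega]
  rw [Nat.factorial_succ, Nat.factorial_succ]
  have := Nat.self_le_factorial t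
  calc (t + 2) * (t + 1) * t = (t + 2) * ((t + 1) * t) := by ring
    _ ≤ (t + 1 + 1) * ((t + 1) * t !) := by
        have : (t + 1) * t ≤ (t + 1) * t ! := Nat.mul_le_mul_left _ this
        simpa [add_assoc] using Nat.mul_le_mul_left (t + 2) this

/-- **THE MARGINS AT A DELETED BLOCK (as a lemma).** At an anchor `i ≥ 4`, `M = 2^i`, the block index `j`
with `e_j = a_i`, `e_{j+1} = a_i + s_i` realises the scale chain
`M! ≤ c_j`, `c_j + M! ≤ (M+1)!`, `c_j + M! ≤ c_{j+1}`, `(M+1)! + M! ≤ (M+2)!`, `(M+1)! + M! ≤ c_{j+1}`,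
`c_{j+1} + M! ≤ (M+2)!`, `c_{j+1} + M! ≤ c_{j+2}` (every gap `≥ M!`), with the height bound `c_{j+1} ≤ 2·M!·(M·i)`. -/
theorem deletedBlock_margins {i : ℕ} (hi4 : 4 ≤ i) :
    ∃ j, (2 ^ i)! ≤ cS j ∧ cS j + (2 ^ i)! ≤ (2 ^ i + 1)! ∧ cS j + (2 ^ i)! ≤ cS (j + 1) ∧
      (2 ^ i + 1)! + (2 ^ i)! ≤ (2 ^ i + 1 + 1)! ∧ (2 ^ i + 1)! + (2 ^ i)! ≤ cS (j + 1) ∧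
      cS (j + 1) + (2 ^ i)! ≤ (2 ^ i + 1 + 1)! ∧ cS (j + 1) + (2 ^ i)! ≤ cS (j + 1 + 1) ∧
      cS (j + 1) ≤ 2 * (2 ^ i)! * (2 ^ i * i) := by
  have hi1 : 1 ≤ i := by omega
  obtain ⟨j, hj1, hj2⟩ := eS_anchor hi4
  have hA1 : (2 ^ i)! < 2 ^ aI i := factorial_lt_two_pow_aI i
  have hA2 : 2 ^ aI i ≤ 2 * (2 ^ i)! := two_pow_aI_le i
  have hS1 : 4 * 2 ^ i ≤ 2 ^ sI i := by
    have hlog : 2 ≤ Nat.log 2 i := Nat.le_log_of_pow_le (by norm_num) (by simpa using hi4)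
    unfold sI
    calc 4 * 2 ^ i = 2 ^ (i + 2) := by rw [pow_add]; ring
      _ ≤ 2 ^ (i + Nat.log 2 i) := Nat.pow_le_pow_right two_pos (by omega)
  have hS2 : 2 ^ sI i ≤ 2 ^ i * i := two_pow_sI_le hi1
  have hiM : 4 * i ≤ 2 ^ i := four_mul_le_two_pow hi4
  set M : ℕ := 2 ^ i with hMdef
  have hM16 : 16 ≤ M := by
    rw [hMdef]
    calc 16 = 2 ^ 4 := by norm_num
      _ ≤ 2 ^ i := Nat.pow_le_pow_right two_pos hi4
  have hcj : cS j = 2 ^ aI i := by unfold cS; rw [hj1]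
  have hcj1 : cS (j + 1) = 2 ^ aI i * 2 ^ sI i := by unfold cS; rw [hj2, pow_add]
  have hMf : M ≤ M ! := Nat.self_le_factorial M
  have iA1 : M ! ≤ cS j := by rw [hcj]; exact hA1.le
  have iA2 : cS j + M ! ≤ (M + 1)! := by
    rw [hcj, Nat.factorial_succ]
    calc 2 ^ aI i + M ! ≤ 2 * M ! + M ! := by omega
      _ = 3 * M ! := by ring
      _ ≤ (M + 1) * M ! := Nat.mul_le_mul_right _ (by omega)
  have iA3 : cS j + M ! ≤ cS (j + 1) := by
    rw [hcj1, hcj]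
    have h4 : 4 ≤ 2 ^ sI i := le_trans (by omega) hS1
    calc 2 ^ aI i + M ! ≤ 2 ^ aI i + 2 ^ aI i := by omega
      _ = 2 ^ aI i * 2 := by ring
      _ ≤ 2 ^ aI i * 2 ^ sI i := Nat.mul_le_mul_left _ (le_trans (by norm_num) h4)
  have iB2 : (M + 1)! + M ! ≤ (M + 1 + 1)! := by
    rw [Nat.factorial_succ (M + 1)]
    have h1 : M ! ≤ (M + 1)! := Nat.factorial_le (Nat.le_succ M)
    calc (M + 1)! + M ! ≤ (M + 1)! + (M + 1)! := by omega
      _ = 2 * (M + 1)! := by ring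
      _ ≤ (M + 1 + 1) * (M + 1)! := Nat.mul_le_mul_right _ (by omega)
  have iB3 : (M + 1)! + M ! ≤ cS (j + 1) := by
    rw [hcj1, Nat.factorial_succ]
    calc (M + 1) * M ! + M ! = (M + 2) * M ! := by ring
      _ ≤ (4 * M) * M ! := Nat.mul_le_mul_right _ (by omega)
      _ ≤ 2 ^ sI i * 2 ^ aI i := Nat.mul_le_mul hS1 hA1.le
      _ = 2 ^ aI i * 2 ^ sI i := mul_comm _ _
  have iC2 : cS (j + 1) + M ! ≤ (M + 1 + 1)! := by
    rw [hcj1, Nat.factorial_succ (M + 1), Nat.factorial_succ M]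
    have h1 : 2 ^ aI i * 2 ^ sI i ≤ 2 * M ! * (M * i) := Nat.mul_le_mul hA2 hS2
    have h2 : 2 * (M * i) + 1 ≤ (M + 1 + 1) * (M + 1) := by nlinarith [hiM, hM16]
    calc 2 ^ aI i * 2 ^ sI i + M ! ≤ 2 * M ! * (M * i) + M ! := by omega
      _ = (2 * (M * i) + 1) * M ! := by ring
      _ ≤ ((M + 1 + 1) * (M + 1)) * M ! := Nat.mul_le_mul_right _ h2
      _ = (M + 1 + 1) * ((M + 1) * M !) := by ring
  have iC3 : cS (j + 1) + M ! ≤ cS (j + 1 + 1) := by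
    have h1 := two_mul_cS_le_succ (j + 1)
    have h2 : M ! ≤ cS (j + 1) := le_trans (Nat.le_add_left _ _) iB3
    omega
  have hcle : cS (j + 1) ≤ 2 * M ! * (M * i) := by rw [hcj1]; exact Nat.mul_le_mul hA2 hS2
  exact ⟨j, iA1, iA2, iA3, iB2, iB3, iC2, iC3, hcle⟩

set_option maxHeartbeats 1600000 in
/-- **THE THREE-CUT FORM BOUND at the member** (hypothesis-free): every non-zero integer form in `(1, ℓ₂, ρ⋆)`
satisfies `exp(−(1+Σ|gᵢ|)^85) ≤ |g₀ + g₁ℓ₂ + g₂ρ⋆|`. -/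
theorem form_lower_bound_S (g : Fin 3 → ℤ) (hg : g ≠ 0) :
    Real.exp (-((1 + ∑ i, (|g i| : ℝ)) ^ 85)) ≤
      |(g 0 : ℝ) + g 1 * liouvilleNumber 2 + g 2 * rhoStar| := by
  classical
  set HR : ℝ := ∑ i, (|g i| : ℝ) with hHR
  have hHR0 : 0 ≤ HR := by
    rw [hHR]; exact Finset.sum_nonneg fun i _ => by exact_mod_cast abs_nonneg (g i)
  have hexp1 : Real.exp (-((1 + HR) ^ 85)) ≤ 1 := by
    rw [Real.exp_le_one_iff]
    have : (0 : ℝ) ≤ (1 + HR) ^ 85 := by positivity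
    linarith
  by_cases h12 : g 1 = 0 ∧ g 2 = 0
  · -- `φ = g₀`, a non-zero integer
    have hg0 : g 0 ≠ 0 := by
      intro h0; apply hg; funext i
      fin_cases i <;> simp [h0, h12.1, h12.2]
    have h1 : (1 : ℝ) ≤ |(g 0 : ℝ) + g 1 * liouvilleNumber 2 + g 2 * rhoStar| := by
      simp only [h12.1, h12.2, Int.cast_zero, zero_mul, add_zero]
      exact_mod_cast Int.one_le_abs hg0
    linarith
  · -- the natural height `Hn` and the anchor `i = k₀ + 4`, `M = 2^i`
    set Hn : ℕ := ∑ i, (g i).natAbs with hHn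
    have hHRn : HR = (Hn : ℝ) := by
      rw [hHR, hHn, Nat.cast_sum]
      refine Finset.sum_congr rfl fun i _ => ?_
      simp only [Nat.cast_natAbs, Int.cast_abs]
    have hHn1 : 1 ≤ Hn := by
      obtain ⟨i, hi⟩ := Function.ne_iff.mp hg
      have hi' : g i ≠ 0 := by simpa using hi
      have h1 : 1 ≤ (g i).natAbs := Int.natAbs_pos.mpr hi'
      exact h1.trans (Finset.single_le_sum (f := fun i => (g i).natAbs) (fun _ _ => Nat.zero_le _)
        (Finset.mem_univ i))
    have hex : ∃ k : ℕ, 8 * Hn ≤ 2 ^ (2 ^ (k + 4))! := by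
      refine ⟨8 * Hn, (Nat.lt_two_pow_self).le.trans (Nat.pow_le_pow_right (by norm_num) ?_)⟩
      exact ((Nat.le_add_right _ 4).trans (Nat.lt_two_pow_self).le).trans (Nat.self_le_factorial _)
    set k₀ : ℕ := Nat.find hex with hk₀
    have hk₀spec : 8 * Hn ≤ 2 ^ (2 ^ (k₀ + 4))! := Nat.find_spec hex
    set i : ℕ := k₀ + 4 with hidef
    have hi4 : 4 ≤ i := by omega
    have hi1 : 1 ≤ i := by omega
    obtain ⟨j, iA1, iA2, iA3, iB2, iB3, iC2, iC3, hcle⟩ := deletedBlock_margins hi4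
    set M : ℕ := 2 ^ i with hMdef
    have hM16 : 16 ≤ M := by
      rw [hMdef]
      calc 16 = 2 ^ 4 := by norm_num
        _ ≤ 2 ^ i := Nat.pow_le_pow_right two_pos hi4
    have hHN : 8 * Hn ≤ 2 ^ M ! := hk₀spec
    -- the deleted block at the anchor (margins lemma): `e_j = a_i`, `e_{j+1} = a_i + s_i`
    have hMf : M ≤ M ! := Nat.self_le_factorial M
    have hiM : 4 * i ≤ M := four_mul_le_two_pow hi4
    have iB1 : cS j ≤ (M + 1)! := le_trans (Nat.le_add_right _ _) iA2
    have iC1 : (M + 1)! ≤ cS (j + 1) := le_trans (Nat.le_add_right _ _) iB3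
    have hcjj1 : cS j ≤ cS (j + 1) := (cS_lt_succ j).le
    -- `c_{j+1} + 1 ≤ (1 + Hn)^85` (minimality of the anchor)
    have h2Hn : 2 ≤ 1 + Hn := by omega
    have hcB : cS (j + 1) + 1 ≤ (1 + Hn) ^ 85 := by
      rcases Nat.eq_zero_or_pos k₀ with hz | hpos
      · -- i = 4, M = 16: c ≤ 2 · 16! · 64 ≤ 2^71
        have hi : i = 4 := by omega
        have hM : M = 16 := by rw [hMdef, hi]; norm_num
        have h16 : (16 : ℕ)! ≤ 2 ^ 64 := by
          calc (16 : ℕ)! ≤ 16 ^ 16 := Nat.factorial_le_pow 16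
            _ = 2 ^ 64 := by norm_num
        have h1 : cS (j + 1) ≤ 2 ^ 71 := by
          rw [hM, hi] at hcle
          calc cS (j + 1) ≤ 2 * (16 : ℕ)! * (16 * 4) := hcle
            _ ≤ 2 * 2 ^ 64 * (16 * 4) := by gcongr
            _ = 2 ^ 71 := by norm_num
        calc cS (j + 1) + 1 ≤ 2 ^ 71 + 1 := by omega
          _ ≤ 2 ^ 72 := by norm_num
          _ ≤ (1 + Hn) ^ 72 := Nat.pow_le_pow_left h2Hn 72
          _ ≤ (1 + Hn) ^ 85 := Nat.pow_le_pow_right (by omega) (by norm_num)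
      · -- k₀ ≥ 1: minimality gives `2^{m!} < 8 Hn` with `m = 2^{i-1}`, whence `M! ≤ 2^{i M} ≤ 2^{m!} < 8 Hn`
        have hmin := Nat.find_min hex (m := k₀ - 1) (by omega)
        set m : ℕ := 2 ^ (k₀ - 1 + 4) with hmdef
        have hlt : 2 ^ m ! < 8 * Hn := not_le.mp hmin
        have hMm : M = 2 * m := by
          rw [hMdef, hmdef, hidef, ← pow_succ']; congr 1; omega
        have hm16 : 16 ≤ m := by
          rw [hmdef]
          calc 16 = 2 ^ 4 := by norm_num
            _ ≤ 2 ^ (k₀ - 1 + 4) := Nat.pow_le_pow_right two_pos (by omega)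
        have him : i ≤ m := by
          rw [hidef, hmdef]
          have := (Nat.lt_two_pow_self : k₀ - 1 + 4 < 2 ^ (k₀ - 1 + 4))
          omega
        have hiM' : i * M ≤ m ! := by
          have h1 : i * M ≤ m * (2 * m) := by rw [hMm]; exact Nat.mul_le_mul_right _ him
          have h2 : m * (2 * m) ≤ m * (m - 1) * (m - 2) := by
            have h3 : 2 * m ≤ (m - 1) * (m - 2) := by
              have h7 : 15 * (m - 2) ≤ (m - 1) * (m - 2) := Nat.mul_le_mul_right _ (by omega)
              omega
            calc m * (2 * m) ≤ m * ((m - 1) * (m - 2)) := Nat.mul_le_mul_left _ h3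
              _ = m * (m - 1) * (m - 2) := by ring
          exact h1.trans (h2.trans (mul_mul_le_factorial (by omega)))
        have hMfact : M ! < 8 * Hn := by
          calc M ! ≤ M ^ M := Nat.factorial_le_pow M
            _ = 2 ^ (i * M) := by rw [hMdef, ← pow_mul]
            _ ≤ 2 ^ m ! := Nat.pow_le_pow_right two_pos hiM'
            _ < 8 * Hn := hlt
        have hMlt : M < 8 * Hn := lt_of_le_of_lt hMf hMfact
        have hilt : i ≤ 8 * Hn := (le_trans (le_trans (Nat.le_mul_of_pos_left i (by norm_num)) hiM) hMlt.le)
        have h1 : cS (j + 1) ≤ 2 * (8 * Hn) * ((8 * Hn) * (8 * Hn)) :=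
          hcle.trans (Nat.mul_le_mul (Nat.mul_le_mul_left 2 hMfact.le) (Nat.mul_le_mul hMlt.le hilt))
        have h2 : 2 * (8 * Hn) * ((8 * Hn) * (8 * Hn)) + 1 ≤ (1 + Hn) ^ 13 := by
          have h3 : 1024 ≤ (1 + Hn) ^ 10 := by
            calc 1024 = 2 ^ 10 := by norm_num
              _ ≤ (1 + Hn) ^ 10 := Nat.pow_le_pow_left h2Hn 10
          have h4 : Hn ^ 3 + 1 ≤ (1 + Hn) ^ 3 := by nlinarith
          calc 2 * (8 * Hn) * ((8 * Hn) * (8 * Hn)) + 1 = 1024 * Hn ^ 3 + 1 := by ring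
            _ ≤ 1024 * (Hn ^ 3 + 1) := by omega
            _ ≤ (1 + Hn) ^ 10 * (1 + Hn) ^ 3 := Nat.mul_le_mul h3 h4
            _ = (1 + Hn) ^ 13 := by rw [← pow_add]
        calc cS (j + 1) + 1 ≤ 2 * (8 * Hn) * ((8 * Hn) * (8 * Hn)) + 1 := by omega
          _ ≤ (1 + Hn) ^ 13 := h2
          _ ≤ (1 + Hn) ^ 85 := Nat.pow_le_pow_right (by omega) (by norm_num)
    have hcBR : ((cS (j + 1) : ℕ) : ℝ) + 1 ≤ (1 + HR) ^ 85 := by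
      rw [hHRn]; exact_mod_cast hcB
    -- the target in terms of the finest resolution `2^{−c_{j+1}}/2`
    have hgoal : Real.exp (-((1 + HR) ^ 85)) ≤ 1 / (2 : ℝ) ^ cS (j + 1) / 2 := by
      have hlog2 : Real.log 2 ≤ 1 := by have := Real.log_two_lt_d9; linarith
      have e1 : 1 / (2 : ℝ) ^ cS (j + 1) / 2 = Real.exp (-(((cS (j + 1) + 1 : ℕ) : ℝ) * Real.log 2)) := by
        rw [Real.exp_neg, Real.exp_nat_mul, Real.exp_log two_pos, pow_succ]
        field_simp
      rw [e1, Real.exp_le_exp, neg_le_neg_iff]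
      push_cast
      calc ((cS (j + 1) : ℝ) + 1) * Real.log 2 ≤ ((cS (j + 1) : ℝ) + 1) * 1 :=
            mul_le_mul_of_nonneg_left hlog2 (by positivity)
        _ ≤ (1 + HR) ^ 85 := by rw [mul_one]; exact hcBR
    -- the truncation errors: at a cut whose error exponents exceed `e + M!` the error is `≤ 2^{−e}/2`
    have hHsum : |(g 1 : ℝ)| + |(g 2 : ℝ)| ≤ HR := by
      rw [hHR, Fin.sum_univ_three]; linarith [abs_nonneg (g 0 : ℝ)]
    have hHNR : 8 * HR ≤ (2 : ℝ) ^ M ! := by rw [hHRn]; exact_mod_cast hHN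
    have herr : ∀ {e f₁ f₂ : ℕ}, e + M ! ≤ f₁ → e + M ! ≤ f₂ →
        |(g 1 : ℝ)| * (2 / 2 ^ f₁) + |(g 2 : ℝ)| * (2 / (2 : ℝ) ^ f₂) ≤ 1 / (2 : ℝ) ^ e / 2 := by
      intro e f₁ f₂ hf₁ hf₂
      have b1 : (2 : ℝ) / 2 ^ f₁ ≤ 2 / 2 ^ (e + M !) :=
        div_le_div_of_nonneg_left (by norm_num) (by positivity) (pow_le_pow_right₀ (by norm_num) hf₁)
      have b2 : (2 : ℝ) / 2 ^ f₂ ≤ 2 / 2 ^ (e + M !) :=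
        div_le_div_of_nonneg_left (by norm_num) (by positivity) (pow_le_pow_right₀ (by norm_num) hf₂)
      have hpe : (0 : ℝ) < 2 ^ e := by positivity
      have key : HR * (2 / (2 : ℝ) ^ (e + M !)) ≤ 1 / (2 : ℝ) ^ e / 2 := by
        rw [pow_add, div_div, mul_div_assoc', div_le_div_iff₀ (by positivity) (by positivity), one_mul]
        have := mul_le_mul_of_nonneg_left hHNR hpe.le
        nlinarith
      calc |(g 1 : ℝ)| * (2 / 2 ^ f₁) + |(g 2 : ℝ)| * (2 / (2 : ℝ) ^ f₂)
          ≤ |(g 1 : ℝ)| * (2 / 2 ^ (e + M !)) + |(g 2 : ℝ)| * (2 / 2 ^ (e + M !)) := by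
            gcongr
        _ = (|(g 1 : ℝ)| + |(g 2 : ℝ)|) * (2 / 2 ^ (e + M !)) := by ring
        _ ≤ HR * (2 / 2 ^ (e + M !)) := by gcongr
        _ ≤ 1 / (2 : ℝ) ^ e / 2 := key
    -- finishing move at a non-vanishing cut of resolution `2^{−e}`, `e ≤ c_{j+1}`
    set frm : ℝ := (g 0 : ℝ) + g 1 * liouvilleNumber 2 + g 2 * rhoStar with hfrm
    have finish : ∀ {e : ℕ} {Φ : ℝ}, e ≤ cS (j + 1) → 1 / (2 : ℝ) ^ e ≤ |Φ| →
        |frm - Φ| ≤ 1 / (2 : ℝ) ^ e / 2 → Real.exp (-((1 + HR) ^ 85)) ≤ |frm| := by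
      intro e Φ he hlow happ
      have h1 : |Φ| - |frm - Φ| ≤ |frm| := by
        have := abs_sub_abs_le_abs_sub Φ frm
        rw [abs_sub_comm Φ frm] at this
        linarith
      have h2 : 1 / (2 : ℝ) ^ cS (j + 1) ≤ 1 / (2 : ℝ) ^ e :=
        one_div_le_one_div_of_le (by positivity) (pow_le_pow_right₀ (by norm_num) he)
      linarith [hgoal]
    by_cases hΦ1 : (g 0 : ℝ) + g 1 * partialSum 2 M + g 2 * tS j ≠ 0
    · -- cut `(M, j)`, resolution `2^{−2^{a_i}}`
      exact finish hcjj1 (formS_scale_lower g iA1 le_rfl hΦ1) ((formS_approx g M j).trans (herr iA2 iA3))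
    by_cases hΦ2 : (g 0 : ℝ) + g 1 * partialSum 2 (M + 1) + g 2 * tS j ≠ 0
    · -- cut `(M+1, j)`, resolution `2^{−(M+1)!}`
      exact finish iC1 (formS_scale_lower g le_rfl iB1 hΦ2)
        ((formS_approx g (M + 1) j).trans (herr iB2 iB3))
    by_cases hΦ3 : (g 0 : ℝ) + g 1 * partialSum 2 (M + 1) + g 2 * tS (j + 1) ≠ 0
    · -- cut `(M+1, j+1)`, resolution `2^{−2^{a_i+s_i}}`
      exact finish le_rfl (formS_scale_lower g iC1 le_rfl hΦ3)
        ((formS_approx g (M + 1) (j + 1)).trans (herr iC2 iC3))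
    · exact absurd (formS_three_scale g M j (not_not.mp hΦ1) (not_not.mp hΦ2) (not_not.mp hΦ3)) h12

end ThreeCuts

end Summit.Schanuel.Schanuel.Theorems.RootDecomp1KSkelCell
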